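import Summits.BirchSwinnertonDyer.BirchSwinnertonDyer.Theorems.ByReductionTypeAtTwoTowerLayerCert
import Summits.BirchSwinnertonDyer.Rank1Residual.GaloisImage.InertiaDivisibleAdditive
import Literature.NumberTheory.EllipticCurves.Greenberg1999.ControlLocalKernelsLayerAdditiveProofs
import Literature.NumberTheory.DiophantineGeometry.TateAlgorithmTameTypesOddProofs
import Literature.NumberTheory.DiophantineGeometry.TateAlgorithmAdditiveProofs
import Literature.NumberTheory.EllipticCurves.AdditiveReductionSemistableModelProofs
import Literature.NumberTheory.EllipticCurves.LocalTorsionMultiplicativeProofs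
import HarnessLib

/-!
# Route `ByReductionTypeAtTwo`, crux `MultUpperHalfAtTwo` (item stmt-BirchSwinnertonDyer-19922): the TOWER road —
# ZERO BITS at an odd ADDITIVE prime of Kodaira type `II`, `II*`, `IV` or `IV*` (odd geometric component group)

HONEST FRAMING (cell `bsd-2adic`, run/shared/lean/pub/bsd-2adic/, seat `bsd-2adic-mult-2` GEN 8, HUMAN RULINGS D-0036 / D-0054 /
D-0074 row (A)): research route; THEOREMS ONLY — no definition, no new named fact; nothing is booked; BSD is not proved by any of
this. PARTITION: X5@2 mult (K4ᵐ, RESIDUAL-MAP B1·O1; 1 976 book230 classes; 1 264 of them have an odd additive prime) × p = 2 —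
types-the-object-of (the per-prime local constant of every TOWER-gap certificate of item 19922); closes none.

WHAT. Every tower door of the cell (`KatoHalfPinch.…`, `MultTowerCert.…`, `MultTowerTorsion.…`, `MultTowerNS2.…`) prices an odd place `v` of
ADDITIVE reduction at the blanket constant `C_v = 4` (two bits at each of the `2^{min(j′, e_ℓ)}` places of the layer field): the
`2`-torsion of the local tower kernel `𝒦_{v,n}[2^∞]` is at most `#E[2] = 4` (Greenberg, LNM 1716, p. 88: `|ker r_v| = c_v^{(p)} ≤ 4`).
This file proves the KERNEL refinement the tree already contains in pieces: at an additive `v ∤ 2` whose Kodaira type has ODD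
geometric component group (`c̄_v ∈ {1, 3}`, i.e. types `II`, `II*`, `IV`, `IV*`), **`𝒦_{v,n}[2^∞]` is TRIVIAL at every layer `n`
of every `ℤ₂`-extension** (`C_v = 1`, ZERO bits):
* §1 `finite_and_natCard_localTowerKerPrimary_le_one_of_additive_of_not_dvd` — `#𝒦_{v,n}[p^∞] ≤ 1` from the tree's
  `finite_and_natCard_localTowerKerPrimary_le_of_inertiaPrimary` (`#𝒦_{v,n}[p^∞] ≤ #E(K̄_v)^{I}[p^∞]`, Greenberg p. 87–88) and
  `InertiaDivisible.localPoints_eq_zero_of_absInertia_fixed_of_not_dvd_componentGroupOrder` (`E(K_v^nr)[p^∞] = 0` when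
  `p ∤ c̄_v`: Kodaira–Néron over `K_v^nr`, *AEC* VII.6.1, *ATAEC* Table 4.1), any number field, any prime `p` with `v ∤ p`;
* §2 the PARITY CERTIFICATE over `ℚ`: at an odd prime `ℓ` with `ℓ ∣ c₄`, `ℓ^k ∥ Δ_min` and (`k ∈ {2, 4, 5}` or (`7 ≤ k`, `k ≠ 9`,
  `ℓ^k ∣ c₄³`)) the reduction is additive and `2 ∤ c̄_ℓ` — by the tree's Ogg-type theorem
  `ordMinimalDiscriminant_eq_numComponentsAt_add_one_of_kodairaSymbolAt` (types `III`, `III*`, `I_n*` have `ord Δ_min = 3, 9, n + 6`)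
  and `one_lt_valuation_j_of_kodairaSymbolAt_eq_Istar_succ` (`I_n*`, `n ≥ 1` ⟹ `ord(j) < 0`), i.e. *ATAEC* Table 4.1 read backwards;
* §3 the per-place dispatcher `pTorsion_localTowerKer_le_of_numeric_addv` = tower-1's `pTorsion_localTowerKer_le_of_numeric` with
  a FIFTH disjunct `(additive ∧ 2 ∤ c̄_v ∧ 1 ≤ C)`.
MEASURED EFFECT (seat census, HOME STATUS 2026-08-27T06:40Z): Σ₃ drops on 1 028 of the 1 976 classes; 278 not-yet-landed
`E[2]`-irreducible classes become predicted-feasible at the layer pair `(0,3)`.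

WHAT IS DISPLAYED, NOT PROVED: nothing new — the binders `h33g`/`hM`/`hA` of the sibling disjuncts stay as they are (all three are
tree theorems anyway: `…_holds`). ∀-LEVEL CONTENT: none.

References: R. Greenberg, LNM 1716 (1999), §3 Lemma 3.3 (pp. 86–88); J. H. Silverman, *AEC* (2009) Thm. VII.6.1, VII.5.1;
*ATAEC* (1994) IV.9.4, Table 4.1, Cor. IV.9.2(d).
-/

set_option autoImplicit false
-- the Theorems namespace of this sub repeats the summit name by design (D-0017 nested layout: Summit.<S>.<Sub>)
set_option linter.dupNamespace false

noncomputable section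

open scoped Classical

open NumberField IsDedekindDomain WeierstrassCurve Literature.NumberTheory.EllipticCurves
  Literature.NumberTheory.EllipticCurves.Greenberg1999
  Literature.NumberTheory.GaloisRepresentations
  Literature.NumberTheory.DiophantineGeometry Literature.NumberTheory.DiophantineGeometry.KodairaSymbol
  IsDedekindDomain.HeightOneSpectrum Rat.HeightOneSpectrum

namespace Summit.BirchSwinnertonDyer.BirchSwinnertonDyer.Theorems.MultTowerAddv

universe u

/-! ## §1 `#𝒦_{v,n}[p^∞] ≤ 1` at an additive `v ∤ p` with `p ∤ c̄_v` (any number field, any `ℤ_p`-extension) -/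

/-- **The Kodaira types with EVEN geometric component group are `III`, `III*` and `I_n*`** (`c̄ = 2, 2, 4`; the other additive
types `II`, `IV`, `IV*`, `II*` have `c̄ = 1, 3, 3, 1`, and `I_n` has `c̄ = max n 1`). *ATAEC* Table 4.1.
[cite: SilvermanATAEC1994, IV.9 Table 4.1 (PDF p. 365)] -/
theorem kodairaSymbol_of_two_dvd_componentGroupOrder {k : KodairaSymbol} (hk : k.IsAdditive)
    (h2 : 2 ∣ k.componentGroupOrder) : k = .III ∨ k = .IIIstar ∨ ∃ n, k = .Istar n := by
  cases k with
  | I n => exact absurd hk (by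
      rcases Nat.eq_zero_or_pos n with rfl | hn
      · exact fun h ↦ h.1 rfl
      · exact fun h ↦ h.2 ⟨n, hn.ne', rfl⟩)
  | II => exact absurd h2 (by decide)
  | III => exact Or.inl rfl
  | IV => exact absurd h2 (by decide)
  | Istar n => exact Or.inr (Or.inr ⟨n, rfl⟩)
  | IVstar => exact absurd h2 (by decide)
  | IIIstar => exact Or.inr (Or.inl rfl)
  | IIstar => exact absurd h2 (by decide)

section Local

variable {K : Type u} [Field K] [NumberField K] (W : WeierstrassCurve K) {v : HeightOneSpectrum (𝓞 K)}
  {p : ℕ} [Fact p.Prime] (κ : ZpExtension K p)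

set_option maxHeartbeats 1600000 in
/-- **`𝒦_{v,n}[p^∞]` is TRIVIAL at an additive `v ∤ p` whose Kodaira type has `p ∤ c̄_v`**, at EVERY layer `n` of ANY
`ℤ_p`-extension: `#𝒦_{v,n}[p^∞] ≤ #E(K̄_v)^{I}[p^∞]` (Greenberg, LNM 1716, pp. 87–88; tree
`finite_and_natCard_localTowerKerPrimary_le_of_inertiaPrimary`) and `E(K_v^nr)[p^∞] = 0` (Kodaira–Néron over `K_v^nr`: the index
`[E(K_v^nr) : E₀(K_v^nr)] = c̄_v` is prime to `p` and `E₀(K_v^nr)` of a cuspidal model has no `p`-torsion; tree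
`InertiaDivisible.localPoints_eq_zero_of_absInertia_fixed_of_not_dvd_componentGroupOrder`). For `p = 2` this is the case of the
types `II`, `II*`, `IV`, `IV*`. [cite: GreenbergLNM1716, §3 Lemma 3.3 (proof, PDF pp. 87–88)]
[cite: SilvermanAEC2009, Thm. VII.6.1 (PDF p. 177)] [cite: SilvermanATAEC1994, Cor. IV.9.2(d) with Table 4.1 (PDF pp. 340, 365)] -/
theorem finite_and_natCard_localTowerKerPrimary_le_one_of_additive_of_not_dvd [W.IsElliptic]
    (hpv : ((p : ℕ) : 𝓞 K) ∉ v.asIdeal) (hadd : W.HasAdditiveReductionAt v)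
    (hps : ¬ p ∣ (W.kodairaSymbolAt v).componentGroupOrder) (n : ℕ) :
    Finite (W.localTowerKerPrimary κ (v.adicCompletion K) n) ∧
      Nat.card (W.localTowerKerPrimary κ (v.adicCompletion K) n) ≤ 1 := by
  classical
  let G : Type u := Field.absoluteGaloisGroup (v.adicCompletion K)
  let Pt : Type u := localPoints W (v.adicCompletion K)
  -- the prime `𝔐`, a Frobenius, the generator `g = F^M`
  obtain ⟨𝔐, h𝔐⟩ := v.localPrimesAbove_nonempty
  haveI hInormal : (𝔐.inertia G).Normal := inertia_normal_of_mem_localPrimesAbove v h𝔐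
  obtain ⟨F, hF⟩ := exists_isArithFrobAt_localAbsIntegers (v := v) h𝔐
  obtain ⟨M, -, hgHn, hgen⟩ := exists_frobenius_pow_generate_localSubgroup κ hpv h𝔐 hF n
  obtain ⟨w, hw⟩ := v.exists_spectralValuation
  have hIeq : 𝔐.inertia (Field.absoluteGaloisGroup (v.adicCompletion K)) = absInertia (v.adicCompletion K) :=
    v.inertia_eq_absInertia hw h𝔐
  -- `B' = E(K̄_v)^{I}[p^∞]` is trivial
  set Mi : AddSubgroup Pt := FixedPoints.addSubgroup (𝔐.inertia G) Pt with hMi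
  set B : AddSubgroup Mi := AddCommGroup.primaryComponent Mi p with hB
  have hB0 : ∀ b : B, b = 0 := by
    intro b
    obtain ⟨k, hk⟩ := (AddCommGroup.mem_primaryComponent).mp b.2
    have hfix : ∀ τ ∈ absInertia (v.adicCompletion K), τ • ((b : Mi) : Pt) = ((b : Mi) : Pt) := by
      intro τ hτ
      have hτ' : τ ∈ 𝔐.inertia G := by rw [hIeq]; exact hτ
      exact (b : Mi).2 ⟨τ, hτ'⟩
    have hkP : p ^ k • ((b : Mi) : Pt) = 0 := by
      have h := congrArg (fun x : Mi ↦ (x : Pt)) hk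
      simpa using h
    have h0 : ((b : Mi) : Pt) = 0 :=
      Summit.BirchSwinnertonDyer.Rank1Residual.GaloisImage.InertiaDivisible.localPoints_eq_zero_of_absInertia_fixed_of_not_dvd_componentGroupOrder
        W hpv hadd hps _ hfix k hkP
    exact Subtype.ext (Subtype.ext h0)
  haveI : Subsingleton B := ⟨fun a b ↦ by rw [hB0 a, hB0 b]⟩
  haveI : Finite B := Finite.of_subsingleton
  have hB1 : Nat.card B ≤ 1 := Finite.card_le_one_iff_subsingleton.mpr inferInstance
  exact finite_and_natCard_localTowerKerPrimary_le_of_inertiaPrimary W κ hpv n h𝔐 hgHn hgen (N := 1)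
    inferInstance hB1

/-- **Corollary (counted currency): `#𝒦_{v,n}[p^∞][p] ≤ 1`** — the `p`-torsion classes of a trivial group.
[cite: GreenbergLNM1716, §3 Lemma 3.3 (proof, PDF p. 88)] -/
theorem pTorsion_le_one_of_additive_of_not_dvd [W.IsElliptic]
    (hpv : ((p : ℕ) : 𝓞 K) ∉ v.asIdeal) (hadd : W.HasAdditiveReductionAt v)
    (hps : ¬ p ∣ (W.kodairaSymbolAt v).componentGroupOrder) (n : ℕ) :
    Finite {x : W.localTowerKerPrimary κ (v.adicCompletion K) n // p • x = 0} ∧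
      Nat.card {x : W.localTowerKerPrimary κ (v.adicCompletion K) n // p • x = 0} ≤ 1 := by
  obtain ⟨hfin, hle⟩ := finite_and_natCard_localTowerKerPrimary_le_one_of_additive_of_not_dvd W κ hpv hadd hps n
  haveI := hfin
  exact ⟨Finite.of_injective _ Subtype.val_injective,
    (Nat.card_le_card_of_injective _ Subtype.val_injective).trans hle⟩

end Local

/-! ## §2 The parity certificate over `ℚ`: `2 ∤ c̄_ℓ` from `(ord_ℓ Δ_min, ord_ℓ c₄)` -/

section Parity

variable (W : WeierstrassCurve ℚ) [W.IsElliptic] [W.IsGloballyMinimal]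

omit [W.IsGloballyMinimal] in
/-- The residue ring of `𝓞 ℚ` at an odd place has characteristic `≠ 2`. [folklore] -/
theorem ringChar_quot_ne_two (v : HeightOneSpectrum (𝓞 ℚ)) (h2v : ((2 : ℕ) : 𝓞 ℚ) ∉ v.asIdeal) :
    ringChar (𝓞 ℚ ⧸ v.asIdeal) ≠ 2 := by
  intro h
  apply h2v
  have h0 : ((2 : ℕ) : 𝓞 ℚ ⧸ v.asIdeal) = 0 := by
    rw [ringChar.spec, h]
  rwa [← map_natCast (Ideal.Quotient.mk v.asIdeal), Ideal.Quotient.eq_zero_iff_mem] at h0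

/-- **`ord_v(j) ≥ 0` from `ℓ^k ∥ Δ_min` and `ℓ^k ∣ c₄³`** (globally minimal `W/ℚ`, `v ↔ ℓ`): `j = c₄³/Δ_min` has
`v`-valuation `≤ 1`. [cite: SilvermanAEC2009, VII.1 Prop. 1.3 and III.1 (j = c₄³/Δ)] -/
theorem valuation_j_le_one_of_dvd (v : HeightOneSpectrum (𝓞 ℚ)) {ℓ : ℕ} [Fact ℓ.Prime]
    (hv : (primesEquiv v : ℕ) = ℓ) {k : ℕ} (hk : (ℓ : ℤ) ^ k ∣ W.minimalDiscriminantInt)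
    (hk' : ¬ (ℓ : ℤ) ^ (k + 1) ∣ W.minimalDiscriminantInt) (hc : (ℓ : ℤ) ^ k ∣ (integralModelInt W).c₄ ^ 3) :
    v.valuation ℚ W.j ≤ 1 := by
  have hgen : natGenerator v = ℓ := hv
  -- `Δ_min = ℓ^k u`, `ℓ ∤ u`
  obtain ⟨u, hu⟩ := hk
  have hℓu : ¬ (ℓ : ℤ) ∣ u := fun h ↦ hk' (by rw [hu, pow_succ]; exact mul_dvd_mul_left _ h)
  have hvℓ : v.valuation ℚ (ℓ : ℚ) = WithZero.exp (-1 : ℤ) := by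
    rw [← hgen]; exact Literature.NumberTheory.GaloisRepresentations.Rat.valuation_natGenerator v
  have hvu : v.valuation ℚ (u : ℚ) = 1 :=
    Literature.NumberTheory.GaloisRepresentations.Rat.valuation_intCast_eq_one v (by rwa [hgen])
  have hexp : (WithZero.exp (-1 : ℤ)) ^ k = WithZero.exp (-(k : ℤ)) := by
    rw [← WithZero.exp_nsmul]; simp
  have hΔ : v.valuation ℚ W.Δ = WithZero.exp (-(k : ℤ)) := by
    rw [← cast_minimalDiscriminantInt W, hu]
    push_cast
    rw [map_mul, map_pow, hvℓ, hvu, mul_one, hexp]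
  have hc₄ : v.valuation ℚ (W.c₄ ^ 3) ≤ WithZero.exp (-(k : ℤ)) := by
    have hc4 : W.c₄ = ((integralModelInt W).c₄ : ℚ) := by
      conv_lhs => rw [← map_integralModelInt W]
      rw [map_c₄, eq_intCast]
    rw [hc4, ← Int.cast_pow]
    exact Literature.NumberTheory.GaloisRepresentations.Rat.valuation_intCast_le v (by rwa [hgen])
  -- `j = Δ'⁻¹ c₄³`
  have hj : W.j = W.Δ⁻¹ * W.c₄ ^ 3 := by
    rw [WeierstrassCurve.j, Units.val_inv_eq_inv_val, coe_Δ']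
  rw [hj, map_mul, map_inv₀, hΔ]
  calc (WithZero.exp (-(k : ℤ)))⁻¹ * v.valuation ℚ (W.c₄ ^ 3)
      ≤ (WithZero.exp (-(k : ℤ)))⁻¹ * WithZero.exp (-(k : ℤ)) := mul_le_mul_right hc₄ _
    _ = 1 := inv_mul_cancel₀ WithZero.coe_ne_zero

/-- **The PARITY CERTIFICATE: additive reduction with ODD geometric component group at an odd prime `ℓ`**, for a globally
minimal `W/ℚ` at the place `v ↔ ℓ`, from decidable data: `ℓ ∣ c₄`, `ℓ^k ∥ Δ_min`, and `k ∈ {2, 4, 5}` or (`7 ≤ k`, `k ≠ 9`,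
`ℓ^k ∣ c₄³`). Proof: `ℓ ∣ Δ_min`, `ℓ ∣ c₄` ⟹ additive (*AEC* VII.5.1(c)); were `c̄_ℓ` even, the type would be `III`, `III*` or `I_n*`
(*ATAEC* Table 4.1), whose `ord_ℓ Δ_min` is `3`, `9`, `n + 6` (`ordMinimalDiscriminant_eq_numComponentsAt_add_one_of_kodairaSymbolAt`,
`ℓ ≠ 2`) — excluded by `k ∈ {2, 4, 5}`; and for `k ≥ 7`, `k ≠ 9` only `I_n*` with `n = k − 6 ≥ 1` remains, which forces `ord_ℓ(j) < 0`
(`one_lt_valuation_j_of_kodairaSymbolAt_eq_Istar_succ`), contradicting `ℓ^k ∣ c₄³`.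
[cite: SilvermanATAEC1994, IV.9.4 and Table 4.1 (PDF pp. 344–346, 365)] [cite: SilvermanAEC2009, VII.5 Prop. 5.1(c)] -/
theorem hasAdditiveReductionAt_and_not_two_dvd_componentGroupOrder_of_cert (v : HeightOneSpectrum (𝓞 ℚ)) {ℓ : ℕ}
    [Fact ℓ.Prime] (hv : (primesEquiv v : ℕ) = ℓ) (hℓ2 : ℓ ≠ 2)
    (hc₄ : (ℓ : ℤ) ∣ (integralModelInt W).c₄) {k : ℕ} (hk : (ℓ : ℤ) ^ k ∣ W.minimalDiscriminantInt)
    (hk' : ¬ (ℓ : ℤ) ^ (k + 1) ∣ W.minimalDiscriminantInt)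
    (hcases : k = 2 ∨ k = 4 ∨ k = 5 ∨ (7 ≤ k ∧ k ≠ 9 ∧ (ℓ : ℤ) ^ k ∣ (integralModelInt W).c₄ ^ 3)) :
    W.HasAdditiveReductionAt v ∧ ¬ 2 ∣ (W.kodairaSymbolAt v).componentGroupOrder := by
  haveI : PerfectField (IsLocalRing.ResidueField (v.adicCompletionIntegers ℚ)) := PerfectField.ofFinite
  have hk1 : 1 ≤ k := by rcases hcases with rfl | rfl | rfl | ⟨h, -, -⟩ <;> omega
  have hℓΔ : (ℓ : ℤ) ∣ W.minimalDiscriminantInt := (dvd_pow_self (ℓ : ℤ) (by omega)).trans hk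
  have hadd : W.HasAdditiveReductionAt v :=
    W.hasAdditiveReductionAt_of_dvd_of_dvd v (by rw [hv]; exact hℓΔ) (by rw [hv]; exact hc₄)
  refine ⟨hadd, fun h2 ↦ ?_⟩
  have h2v : ((2 : ℕ) : 𝓞 ℚ) ∉ v.asIdeal := by
    rw [KatoHalfPinch.natCast_prime_mem_asIdeal_iff v Nat.prime_two]
    change natGenerator v ≠ 2
    rw [show natGenerator v = ℓ from hv]; exact hℓ2
  have hchar : ringChar (𝓞 ℚ ⧸ v.asIdeal) ≠ 2 := ringChar_quot_ne_two v h2v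
  have haddK : (W.kodairaSymbolAt v).IsAdditive := (isAdditive_kodairaSymbolAt_iff_holds v W).mpr hadd
  have hT := kodairaSymbol_of_two_dvd_componentGroupOrder haddK h2
  -- `ord_v Δ_min = m_v + 1` for these types
  have hord : W.ordMinimalDiscriminant v = W.numComponentsAt v + 1 :=
    W.ordMinimalDiscriminant_eq_numComponentsAt_add_one_of_kodairaSymbolAt v hchar
      (by rcases hT with h | h | ⟨n, h⟩
          · exact Or.inl h
          · exact Or.inr (Or.inl h)
          · exact Or.inr (Or.inr ⟨n, h⟩))
  have hordk : W.ordMinimalDiscriminant v = k := by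
    rw [LocalTorsionMult.ordMinimalDiscriminant_eq_padicValInt W v hv,
      KatoHalfPinch.padicValInt_eq_of_dvd_of_not_dvd hk hk']
  unfold numComponentsAt at hord
  rcases hT with h | h | ⟨n, h⟩
  · rw [h] at hord; change W.ordMinimalDiscriminant v = 2 + 1 at hord; omega
  · rw [h] at hord; change W.ordMinimalDiscriminant v = 8 + 1 at hord; omega
  · rw [h, KodairaSymbol.numComponents_Istar] at hord
    rcases hcases with rfl | rfl | rfl | ⟨h7, h9, hc3⟩
    · omega
    · omega
    · omega
    · -- `I_n*` with `n = k - 6 ≥ 1`: `ord(j) < 0`, contradicting `ℓ^k ∣ c₄³`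
      obtain ⟨n', rfl⟩ : ∃ n', n = n' + 1 := ⟨n - 1, by omega⟩
      have hlt := W.one_lt_valuation_j_of_kodairaSymbolAt_eq_Istar_succ v hchar h
      exact absurd (valuation_j_le_one_of_dvd W v hv hk hk' hc3) (not_le.mpr hlt)

end Parity

/-! ## §3 The per-place dispatcher with the FIFTH (zero-bit additive) disjunct -/

section Dispatch

variable (W : WeierstrassCurve ℚ) [W.IsElliptic]

/-- **The local constant at an odd place, from PRINT + the kernel refinement.** For `W/ℚ` elliptic, `κ` cyclotomic at `2`, an odd
place `v` and a layer `n`: `#𝒦_{v,n}[2] ≤ C` as soon as ONE of: `4 ≤ C`; `v` multiplicative and `2 ≤ C`; `v` multiplicative with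
`2 ∤ ord_v(Δ_min)` and `1 ≤ C`; `v` good and `1 ≤ C`; **`v` ADDITIVE with `2 ∤ c̄_v` and `1 ≤ C`** (this file, §1).
(= tower-1's `KatoHalfPinch.pTorsion_localTowerKer_le_of_numeric` + one disjunct.) [cite: GreenbergLNM1716, §3 Lemma 3.3 (PDF pp. 86–88)]
[cite: SilvermanATAEC1994, Cor. IV.9.2(d) with Table 4.1] -/
theorem pTorsion_localTowerKer_le_of_numeric_addv
    (h33g : lemma33_localTowerKerPrimary_eq_bot_of_good.{0})
    (hM : lemma33_localTowerKerPrimary_cyclic_of_multiplicative.{0})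
    (hA : lemma33_natCard_localTowerKerPrimary_le_four_of_additive.{0})
    (κ : ZpExtension ℚ 2) (hκ : κ.IsCyclotomic) (v : HeightOneSpectrum (𝓞 ℚ))
    (h2v : ((2 : ℕ) : 𝓞 ℚ) ∉ v.asIdeal) (n C : ℕ)
    (hC : 4 ≤ C ∨ (W.HasMultiplicativeReductionAt v ∧ 2 ≤ C) ∨
      (W.HasMultiplicativeReductionAt v ∧ ¬ 2 ∣ W.ordMinimalDiscriminant v ∧ 1 ≤ C) ∨
      (W.HasGoodReductionAt v ∧ 1 ≤ C) ∨
      (W.HasAdditiveReductionAt v ∧ ¬ 2 ∣ (W.kodairaSymbolAt v).componentGroupOrder ∧ 1 ≤ C)) :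
    Finite {x : W.localTowerKerPrimary κ (v.adicCompletion ℚ) n // 2 • x = 0} ∧
      Nat.card {x : W.localTowerKerPrimary κ (v.adicCompletion ℚ) n // 2 • x = 0} ≤ C := by
  haveI : Fact (Nat.Prime 2) := ⟨Nat.prime_two⟩
  rcases hC with h | h | h | h | ⟨hadd, hodd, h1⟩
  · exact KatoHalfPinch.pTorsion_localTowerKer_le_of_numeric W h33g hM hA κ hκ v h2v n C (Or.inl h)
  · exact KatoHalfPinch.pTorsion_localTowerKer_le_of_numeric W h33g hM hA κ hκ v h2v n C (Or.inr (Or.inl h))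
  · exact KatoHalfPinch.pTorsion_localTowerKer_le_of_numeric W h33g hM hA κ hκ v h2v n C (Or.inr (Or.inr (Or.inl h)))
  · exact KatoHalfPinch.pTorsion_localTowerKer_le_of_numeric W h33g hM hA κ hκ v h2v n C (Or.inr (Or.inr (Or.inr h)))
  · obtain ⟨hf, hle⟩ := pTorsion_le_one_of_additive_of_not_dvd W κ h2v hadd hodd n
    exact ⟨hf, hle.trans h1⟩

end Dispatch

end Summit.BirchSwinnertonDyer.BirchSwinnertonDyer.Theorems.MultTowerAddv

end
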